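import Mathlib
import HarnessLib
import Summits.NavierStokesRegularity.NavierStokesRegularity.Theorems.TypeILiouvilleStrainLedgerStretchingFloor

/-!
# TypeILiouvilleStrainLedgerOsgoodFloor — crux (L) stmt-NavierStokesRegularity-10661 `TypeIliouvilleL`,
# registered residual L_Q / Type-I door: THE UNIT STRETCHING THRESHOLD IS AN OSGOOD THRESHOLD

Helper for stmt-NavierStokesRegularity-10661 (`--supports`); theorems only, no definitions, no named-fact hypotheses;
closes no item; Navier–Stokes regularity is NOT proved here (leafhand seat of the EulerZoomLiouville route).

Class P = print's class of bounded ancient mild solutions (continuous and bounded on `(−∞,0) × ℝ³`, weakly divergence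
free, Oseen integral equation).  Inputs: starved Liouville `const_of_strainStarved` (`TypeILiouvilleStrainLedgerStarved`),
time-shift invariance `classP_timeShift` and forward rigidity `classP_const_of_const_below`
(`TypeILiouvilleStrainLedgerStretchingFloor`).

The stretching floor of the tree (`const_of_eventually_stretching_le`: eventual stretching number `(−τ)‖∇v(τ,x)‖ ≤ a`
with a CONSTANT `a < 1` ⟹ constant) is sharpened to its Osgood form: what decides is not the constant but the
DIVERGENCE OF THE DEFICIT INTEGRAL `∫_{−∞}^{T} (1 − a(τ)) dτ/(−τ)`.

* §1 `const_of_pastLedger_tendsto_zero` — **EVENTUAL LEDGER LIOUVILLE**: a continuous strain majorant `Λ` and a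
  vorticity majorant `Ω` on a far past `τ < T < 0` with `Ω(s) · exp ∫_s^T Λ → 0` (`s → −∞`) force constancy (the
  time-shifted flow is strain-starved; forward rigidity).
* §2 `const_of_typeIVorticity_of_divergent_deficit` — **OSGOOD FLOOR AT THE TYPE-I VORTICITY RATE**: vorticity at the
  scale-invariant rate `‖curl v(τ,x)‖ ≤ M/(−τ)` (ANY `M`) and stretching form `⟪∇v(τ,x)ξ,ξ⟫ ≤ (a(τ)/(−τ))‖ξ‖²` on a far
  past, with `∫_s^T (1 − a(τ)) dτ/(−τ) → +∞` as `s → −∞`, ⟹ one constant vector (`a` of any sign and size: excursions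
  of the stretching number above `1` are allowed as long as the deficit integral diverges);
  `const_of_stretching_divergent_deficit` — the gradient-norm form `(−τ)‖∇v(τ,x)‖ ≤ a(τ) ≤ A`.
* §3 `const_of_stretching_le_one_sub_div_log` — the quotable log cell: `(−τ)‖∇v(τ,x)‖ ≤ 1 − c/log(−τ)` for
  `τ < T < −1` (`c > 0`) ⟹ constant (deficit integral `c·log log(−s) → ∞`);
  `exists_stretching_gt_one_sub_div_log_of_nonconst` — contrapositive floor: a NON-CONSTANT class-P flow carries, below
  every `T < −1` and for every `c > 0`, a point with stretching number `> 1 − c/log(−τ)`.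

READING on L_Q / door stmt-4050: the tree's floor «`limsup (−τ)·sup_x‖∇v‖ ≥ 1`» for non-constant members is refined to
«the stretching number cannot stay below `1 − c/log(−τ)` (nor below `1 −` any deficit with divergent `∫ ·/(−τ)`)»; the
companion vorticity floor `c/((−τ) log(−τ))` (`TypeILiouvilleLambTailVorticityFloor`) sits one logarithm below the
Type-I rate from the other side.  The scale-invariant rate itself (`a ≡ 1`, any `M`) stays open = Type-I Liouville.
HONEST LABEL: Grönwall bookkeeping on the tree's vorticity-stretching comparison; nothing here proves a registered stub,
(L), or NS regularity; rung 0.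
[cite: MajdaBertozziCUP2002, eq. (3.80)] [cite: KochNadirashviliSereginSverak2009, §4 (i), Remark 6.1 (arXiv:0709.3599)]
[cite: LemarieRieusset2016, Thm. 9.12]
-/

noncomputable section
open MeasureTheory Filter Set Function Metric
open scoped Topology RealInnerProductSpace ENNReal NNReal
open Literature.Analysis Literature.Analysis.FluidPDE Literature.Analysis.UnboundedOperators
set_option linter.dupNamespace false
namespace Summit.NavierStokesRegularity.NavierStokesRegularity.Theorems.TypeILiouvilleStrainLedger

/-! ## §1 Eventual ledger Liouville -/

/-- **EVENTUAL LEDGER LIOUVILLE.**  Let `v` be a class-P flow, `T < 0`, `Λ` a continuous function with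
`⟪∇v(τ,x)ξ,ξ⟫ ≤ Λ τ ‖ξ‖²` for all `τ < T`, and `Ω` with `‖curl v(τ,x)‖ ≤ Ω τ` for all `τ < T`.  If the backward ledger
of the window `[s,T]` tends to zero, `Ω(s) · exp ∫_s^T Λ → 0` as `s → −∞`, then `v` is one constant vector: the
time-shifted flow `t ↦ v(t+T)` is strain-starved (its ledger at `t < 0` from `s` is the ledger of `[s+T, T]` times the
fixed factor `exp(−∫_{t+T}^T Λ)`), hence constant (`const_of_strainStarved`), and forward rigidity
(`classP_const_of_const_below`) finishes. [cite: MajdaBertozziCUP2002, eq. (3.80)] [cite: LemarieRieusset2016, Thm. 9.12] -/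
theorem const_of_pastLedger_tendsto_zero
    {v : ℝ → EuclideanSpace ℝ (Fin 3) → EuclideanSpace ℝ (Fin 3)}
    (hc : ContinuousOn (uncurry v) (Iio 0 ×ˢ univ))
    (hK : ∃ K : ℝ, ∀ t < 0, ∀ x, ‖v t x‖ ≤ K)
    (hd : ∀ t < 0, IsWeaklyDivFree (v t))
    (hm : ∀ s t : ℝ, s < t → t < 0 → ∀ x,
      v t x = heatExtension (v s) (t - s) x - oseenDuhamel 1 s v v t x)
    {T : ℝ} (hT : T < 0) {Λ Ω : ℝ → ℝ} (hΛc : Continuous Λ)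
    (hΛ : ∀ τ < T, ∀ x ξ : EuclideanSpace ℝ (Fin 3), ⟪fderiv ℝ (v τ) x ξ, ξ⟫ ≤ Λ τ * ‖ξ‖ ^ 2)
    (hΩ : ∀ τ < T, ∀ x : EuclideanSpace ℝ (Fin 3), ‖curl (v τ) x‖ ≤ Ω τ)
    (hlim : Tendsto (fun s : ℝ => Ω s * Real.exp (∫ τ in s..T, Λ τ)) atBot (𝓝 0)) :
    ∃ b : EuclideanSpace ℝ (Fin 3), ∀ t < 0, ∀ x, v t x = b := by
  obtain ⟨hc', hK', hd', hm'⟩ := classP_timeShift hc hK hd hm hT.le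
  have hstarved : ∀ t < 0, ∀ ε : ℝ, 0 < ε → ∃ s : ℝ, s < t ∧ ∃ Λ' : ℝ → ℝ, Continuous Λ' ∧
      (∀ τ ∈ Icc s t, ∀ x ξ : EuclideanSpace ℝ (Fin 3),
        ⟪fderiv ℝ (v (τ + T)) x ξ, ξ⟫ ≤ Λ' τ * ‖ξ‖ ^ 2) ∧
      ∃ Ω₀ : ℝ, (∀ x, ‖curl (v (s + T)) x‖ ≤ Ω₀) ∧ Ω₀ * Real.exp (∫ τ in s..t, Λ' τ) < ε := by
    intro t ht ε hε
    -- the fixed factor of the window `[t+T, T]`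
    obtain ⟨c, hc_def⟩ : ∃ c : ℝ, c = Real.exp (-(∫ τ in (t + T)..T, Λ τ)) := ⟨_, rfl⟩
    have hc0 : 0 < c := by rw [hc_def]; exact Real.exp_pos _
    have hεc : 0 < ε / c := div_pos hε hc0
    obtain ⟨σ₀, hσ₀⟩ := (hlim.eventually (gt_mem_nhds hεc)).exists_forall_of_atBot
    set σ : ℝ := min σ₀ (t + T - 1) with hσ
    have hσle : σ ≤ σ₀ := min_le_left _ _
    have hσt : σ < t + T := by have := min_le_right σ₀ (t + T - 1); linarith
    have hσT : σ < T := by linarith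
    refine ⟨σ - T, by linarith, fun τ => Λ (τ + T), hΛc.comp (continuous_id.add continuous_const),
      fun τ hτ x ξ => hΛ (τ + T) (by linarith [hτ.2]) x ξ, Ω σ, fun x => ?_, ?_⟩
    · have h := hΩ σ hσT x
      simpa only [sub_add_cancel] using h
    · have hshift : ∫ τ in (σ - T)..t, Λ (τ + T) = ∫ τ in σ..(t + T), Λ τ := by
        rw [intervalIntegral.integral_comp_add_right]
        simp only [sub_add_cancel]
      have hsplit : ∫ τ in σ..(t + T), Λ τ = (∫ τ in σ..T, Λ τ) - ∫ τ in (t + T)..T, Λ τ := by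
        rw [eq_sub_iff_add_eq]
        exact intervalIntegral.integral_add_adjacent_intervals (hΛc.intervalIntegrable _ _)
          (hΛc.intervalIntegrable _ _)
      have hkey : Ω σ * Real.exp (∫ τ in (σ - T)..t, Λ (τ + T)) =
          Ω σ * Real.exp (∫ τ in σ..T, Λ τ) * c := by
        rw [hshift, hsplit, hc_def, sub_eq_add_neg, Real.exp_add]; ring
      have h1 : Ω σ * Real.exp (∫ τ in σ..T, Λ τ) < ε / c := hσ₀ σ hσle
      calc Ω σ * Real.exp (∫ τ in (σ - T)..t, Λ (τ + T))
          = Ω σ * Real.exp (∫ τ in σ..T, Λ τ) * c := hkey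
        _ < ε / c * c := mul_lt_mul_of_pos_right h1 hc0
        _ = ε := div_mul_cancel₀ ε hc0.ne'
  obtain ⟨b, hb⟩ := const_of_strainStarved (v := fun t x => v (t + T) x) hc' hK' hd' hm' hstarved
  refine ⟨b, classP_const_of_const_below hc hK hm (T := T) fun τ hτ x => ?_⟩
  have h := hb (τ - T) (by linarith) x
  simp only [sub_add_cancel] at h
  exact h

/-! ## §2 Osgood floor at the Type-I vorticity rate -/

/-- `∫_s^T dτ/(−τ) = log(−s) − log(−T)` for `s < T < 0`. [folklore] -/
theorem integral_one_div_neg_eq_log {s T : ℝ} (hsT : s < T) (hT : T < 0) :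
    ∫ τ in s..T, 1 / (-τ) = Real.log (-s) - Real.log (-T) := by
  have hderiv : ∀ τ ∈ uIcc s T, HasDerivAt (fun r : ℝ => -Real.log (-r)) (1 / (-τ)) τ := by
    intro τ hτ
    rw [uIcc_of_le hsT.le] at hτ
    have hτ0 : -τ ≠ 0 := (neg_pos.2 (lt_of_le_of_lt hτ.2 hT)).ne'
    have h1 : HasDerivAt (fun r : ℝ => Real.log (-r)) ((-τ)⁻¹ * (-1)) τ :=
      (Real.hasDerivAt_log hτ0).comp τ (hasDerivAt_neg τ)
    refine h1.neg.congr_deriv ?_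
    rw [one_div]; ring
  have hcont : ContinuousOn (fun τ : ℝ => 1 / (-τ)) (uIcc s T) := by
    refine continuousOn_const.div (continuousOn_id.neg) fun τ hτ => ?_
    rw [uIcc_of_le hsT.le] at hτ
    exact (neg_pos.2 (lt_of_le_of_lt hτ.2 hT)).ne'
  rw [intervalIntegral.integral_eq_sub_of_hasDerivAt hderiv (hcont.intervalIntegrable)]
  ring

/-- **OSGOOD FLOOR AT THE TYPE-I VORTICITY RATE.**  Let `v` be a class-P flow with, on a far past `τ < T < 0`,
vorticity at the scale-invariant rate `‖curl v(τ,x)‖ ≤ M/(−τ)` (any `M`) and stretching form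
`⟪∇v(τ,x)ξ,ξ⟫ ≤ (a(τ)/(−τ))‖ξ‖²` (`a` continuous, any sign and size).  If the DEFICIT INTEGRAL DIVERGES,
`∫_s^T (1 − a(τ)) dτ/(−τ) → +∞` as `s → −∞`, then `v` is one constant vector: the ledger of `[s,T]` is
`(M/(−s)) · ((−s)/(−T)) · exp(−∫_s^T (1−a)/(−τ)) = M e^{−D(s)}/(−T) → 0` (§1).  Constant `a < 1` is the tree's
`const_of_eventually_stretching_lt_vorticity_decay` (`β = 1`); here `a(τ) → 1⁻` slowly, or `a > 1` on stretches, is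
allowed. [cite: MajdaBertozziCUP2002, eq. (3.80)] -/
theorem const_of_typeIVorticity_of_divergent_deficit
    {v : ℝ → EuclideanSpace ℝ (Fin 3) → EuclideanSpace ℝ (Fin 3)}
    (hc : ContinuousOn (uncurry v) (Iio 0 ×ˢ univ))
    (hK : ∃ K : ℝ, ∀ t < 0, ∀ x, ‖v t x‖ ≤ K)
    (hd : ∀ t < 0, IsWeaklyDivFree (v t))
    (hm : ∀ s t : ℝ, s < t → t < 0 → ∀ x,
      v t x = heatExtension (v s) (t - s) x - oseenDuhamel 1 s v v t x)
    {T : ℝ} (hT : T < 0) {a : ℝ → ℝ} (hac : Continuous a) {M : ℝ}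
    (hstr : ∀ τ < T, ∀ x ξ : EuclideanSpace ℝ (Fin 3), ⟪fderiv ℝ (v τ) x ξ, ξ⟫ ≤ a τ / (-τ) * ‖ξ‖ ^ 2)
    (hω : ∀ τ < T, ∀ x : EuclideanSpace ℝ (Fin 3), ‖curl (v τ) x‖ ≤ M / (-τ))
    (hdiv : Tendsto (fun s : ℝ => ∫ τ in s..T, (1 - a τ) / (-τ)) atBot atTop) :
    ∃ b : EuclideanSpace ℝ (Fin 3), ∀ t < 0, ∀ x, v t x = b := by
  have hT0 : 0 < -T := neg_pos.2 hT
  -- continuous majorant on `ℝ`, equal to `a/(−τ)` for `τ ≤ T`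
  set Λ : ℝ → ℝ := fun τ => a τ / max (-τ) (-T) with hΛ
  have hden : ∀ τ : ℝ, max (-τ) (-T) ≠ 0 := fun τ => (lt_of_lt_of_le hT0 (le_max_right _ _)).ne'
  have hΛc : Continuous Λ := hac.div (continuous_neg.max continuous_const) hden
  have hΛeq : ∀ τ, τ ≤ T → Λ τ = a τ / (-τ) := fun τ hτ => by
    simp only [hΛ, max_eq_left (neg_le_neg hτ)]
  refine const_of_pastLedger_tendsto_zero hc hK hd hm hT hΛc (Ω := fun τ => M / (-τ))
    (fun τ hτ x ξ => by rw [hΛeq τ hτ.le]; exact hstr τ hτ x ξ) hω ?_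
  -- the ledger in closed form, eventually
  have hclosed : ∀ s < T, M / (-s) * Real.exp (∫ τ in s..T, Λ τ) =
      M / (-T) * Real.exp (-(∫ τ in s..T, (1 - a τ) / (-τ))) := by
    intro s hs
    have hs0 : 0 < -s := by linarith
    have hcongr : ∫ τ in s..T, Λ τ = ∫ τ in s..T, (1 / (-τ) - (1 - a τ) / (-τ)) := by
      refine intervalIntegral.integral_congr fun τ hτ => ?_
      rw [uIcc_of_le hs.le] at hτ
      rw [hΛeq τ hτ.2, div_sub_div_same]
      ring
    have hcont2 : ContinuousOn (fun τ : ℝ => (1 - a τ) / (-τ)) (uIcc s T) := by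
      refine (continuousOn_const.sub hac.continuousOn).div continuousOn_id.neg fun τ hτ => ?_
      rw [uIcc_of_le hs.le] at hτ
      exact (neg_pos.2 (lt_of_le_of_lt hτ.2 hT)).ne'
    have hcont1 : ContinuousOn (fun τ : ℝ => 1 / (-τ)) (uIcc s T) := by
      refine continuousOn_const.div continuousOn_id.neg fun τ hτ => ?_
      rw [uIcc_of_le hs.le] at hτ
      exact (neg_pos.2 (lt_of_le_of_lt hτ.2 hT)).ne'
    have hs1 : s ≠ 0 := by linarith
    have hT1 : T ≠ 0 := hT.ne
    rw [hcongr, intervalIntegral.integral_sub hcont1.intervalIntegrable hcont2.intervalIntegrable,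
      integral_one_div_neg_eq_log hs hT, sub_eq_add_neg, Real.exp_add, Real.exp_sub, Real.exp_log hs0,
      Real.exp_log hT0]
    field_simp
  have hexp : Tendsto (fun s : ℝ => M / (-T) * Real.exp (-(∫ τ in s..T, (1 - a τ) / (-τ)))) atBot (𝓝 0) := by
    have h := (Real.tendsto_exp_atBot.comp (tendsto_neg_atTop_atBot.comp hdiv)).const_mul (M / (-T))
    rw [mul_zero] at h
    exact h
  refine hexp.congr' ?_
  filter_upwards [eventually_lt_atBot T] with s hs
  exact (hclosed s hs).symm

/-- **OSGOOD STRETCHING FLOOR (gradient-norm form).**  A class-P flow whose stretching number obeys, on a far past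
`τ < T < 0`, `(−τ)·‖∇v(τ,x)‖ ≤ a(τ) ≤ A` with `a` continuous and a DIVERGENT deficit integral
`∫_s^T (1 − a(τ)) dτ/(−τ) → +∞` (`s → −∞`) is one constant vector (vorticity `≤ ‖curl‖·A/(−τ)` is at the Type-I rate;
§2).  With `a ≡ a₀ < 1` this is `const_of_eventually_stretching_le`; the threshold `1` is thus an Osgood threshold.
[cite: MajdaBertozziCUP2002, eq. (3.80)] -/
theorem const_of_stretching_divergent_deficit
    {v : ℝ → EuclideanSpace ℝ (Fin 3) → EuclideanSpace ℝ (Fin 3)}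
    (hc : ContinuousOn (uncurry v) (Iio 0 ×ˢ univ))
    (hK : ∃ K : ℝ, ∀ t < 0, ∀ x, ‖v t x‖ ≤ K)
    (hd : ∀ t < 0, IsWeaklyDivFree (v t))
    (hm : ∀ s t : ℝ, s < t → t < 0 → ∀ x,
      v t x = heatExtension (v s) (t - s) x - oseenDuhamel 1 s v v t x)
    {T : ℝ} (hT : T < 0) {a : ℝ → ℝ} (hac : Continuous a) {A : ℝ} (haA : ∀ τ < T, a τ ≤ A)
    (hstr : ∀ τ < T, ∀ x : EuclideanSpace ℝ (Fin 3), (-τ) * ‖fderiv ℝ (v τ) x‖ ≤ a τ)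
    (hdiv : Tendsto (fun s : ℝ => ∫ τ in s..T, (1 - a τ) / (-τ)) atBot atTop) :
    ∃ b : EuclideanSpace ℝ (Fin 3), ∀ t < 0, ∀ x, v t x = b := by
  have hg : ∀ τ < T, ∀ x : EuclideanSpace ℝ (Fin 3), ‖fderiv ℝ (v τ) x‖ ≤ a τ / (-τ) := by
    intro τ hτ x
    have hτ0 : 0 < -τ := by linarith
    rw [le_div_iff₀ hτ0, mul_comm]
    exact hstr τ hτ x
  refine const_of_typeIVorticity_of_divergent_deficit hc hK hd hm hT hac (M := ‖curlCLM‖ * A)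
    (fun τ hτ x ξ => ?_) (fun τ hτ x => ?_) hdiv
  · calc ⟪fderiv ℝ (v τ) x ξ, ξ⟫ ≤ ‖fderiv ℝ (v τ) x ξ‖ * ‖ξ‖ := real_inner_le_norm _ _
      _ ≤ (‖fderiv ℝ (v τ) x‖ * ‖ξ‖) * ‖ξ‖ :=
          mul_le_mul_of_nonneg_right (ContinuousLinearMap.le_opNorm _ _) (norm_nonneg _)
      _ ≤ (a τ / (-τ) * ‖ξ‖) * ‖ξ‖ :=
          mul_le_mul_of_nonneg_right (mul_le_mul_of_nonneg_right (hg τ hτ x) (norm_nonneg _)) (norm_nonneg _)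
      _ = a τ / (-τ) * ‖ξ‖ ^ 2 := by ring
  · have hτ0 : 0 < -τ := by linarith
    calc ‖curl (v τ) x‖ = ‖curlCLM (fderiv ℝ (v τ) x)‖ := rfl
      _ ≤ ‖curlCLM‖ * ‖fderiv ℝ (v τ) x‖ := ContinuousLinearMap.le_opNorm _ _
      _ ≤ ‖curlCLM‖ * (a τ / (-τ)) := mul_le_mul_of_nonneg_left (hg τ hτ x) (norm_nonneg curlCLM)
      _ ≤ ‖curlCLM‖ * (A / (-τ)) :=
          mul_le_mul_of_nonneg_left (div_le_div_of_nonneg_right (haA τ hτ) hτ0.le) (norm_nonneg curlCLM)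
      _ = ‖curlCLM‖ * A / (-τ) := by ring

/-! ## §3 The logarithmic cell and the refined floor of a non-constant flow -/

/-- `∫_s^T c dτ/((−τ) log(−τ)) = c (log log(−s) − log log(−T))` for `s < T < −1`. [folklore] -/
theorem integral_div_neg_mul_log_eq {s T c : ℝ} (hsT : s < T) (hT : T < -1) :
    ∫ τ in s..T, c / ((-τ) * Real.log (-τ)) = c * (Real.log (Real.log (-s)) - Real.log (Real.log (-T))) := by
  have hpos : ∀ τ ∈ uIcc s T, 1 < -τ := by
    intro τ hτ
    rw [uIcc_of_le hsT.le] at hτ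
    linarith [hτ.2]
  have hderiv : ∀ τ ∈ uIcc s T,
      HasDerivAt (fun r : ℝ => -c * Real.log (Real.log (-r))) (c / ((-τ) * Real.log (-τ))) τ := by
    intro τ hτ
    have h1 : 1 < -τ := hpos τ hτ
    have hτ0 : -τ ≠ 0 := by linarith
    have hlog0 : Real.log (-τ) ≠ 0 := (Real.log_pos h1).ne'
    have hA : HasDerivAt (fun r : ℝ => Real.log (-r)) ((-τ)⁻¹ * (-1)) τ :=
      (Real.hasDerivAt_log hτ0).comp τ (hasDerivAt_neg τ)
    have hB : HasDerivAt (fun r : ℝ => Real.log (Real.log (-r))) (((-τ)⁻¹ * (-1)) / Real.log (-τ)) τ :=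
      hA.log hlog0
    have hτne : τ ≠ 0 := by linarith
    refine (hB.const_mul (-c)).congr_deriv ?_
    field_simp
  have hcont : ContinuousOn (fun τ : ℝ => c / ((-τ) * Real.log (-τ))) (uIcc s T) := by
    refine continuousOn_const.div (continuousOn_id.neg.mul (continuousOn_id.neg.log fun τ hτ => ?_))
      fun τ hτ => ?_
    · have h1 := hpos τ hτ
      exact (lt_trans zero_lt_one h1).ne'
    · have h1 := hpos τ hτ
      exact mul_ne_zero (lt_trans zero_lt_one h1).ne' (Real.log_pos h1).ne'
  rw [intervalIntegral.integral_eq_sub_of_hasDerivAt hderiv hcont.intervalIntegrable]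
  ring

/-- **THE LOGARITHMIC CELL OF THE OSGOOD FLOOR.**  A class-P flow with
`(−τ)·‖∇v(τ,x)‖ ≤ 1 − c/log(−τ)` for all `τ < T` and all `x` (`T < −1`, `c > 0`) is one constant vector: the deficit
integral is `c (log log(−s) − log log(−T)) → +∞` (§2).  One logarithm inside the unit threshold of
`const_of_eventually_stretching_le`, mirroring the vorticity floor `c/((−τ) log(−τ))` of
`TypeILiouvilleLambTail.const_of_vorticity_littleO_log`. [cite: MajdaBertozziCUP2002, eq. (3.80)] -/
theorem const_of_stretching_le_one_sub_div_log
    {v : ℝ → EuclideanSpace ℝ (Fin 3) → EuclideanSpace ℝ (Fin 3)}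
    (hc : ContinuousOn (uncurry v) (Iio 0 ×ˢ univ))
    (hK : ∃ K : ℝ, ∀ t < 0, ∀ x, ‖v t x‖ ≤ K)
    (hd : ∀ t < 0, IsWeaklyDivFree (v t))
    (hm : ∀ s t : ℝ, s < t → t < 0 → ∀ x,
      v t x = heatExtension (v s) (t - s) x - oseenDuhamel 1 s v v t x)
    {T c : ℝ} (hT : T < -1) (hc0 : 0 < c)
    (hstr : ∀ τ < T, ∀ x : EuclideanSpace ℝ (Fin 3),
      (-τ) * ‖fderiv ℝ (v τ) x‖ ≤ 1 - c / Real.log (-τ)) :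
    ∃ b : EuclideanSpace ℝ (Fin 3), ∀ t < 0, ∀ x, v t x = b := by
  have hT0 : T < 0 := by linarith
  have hT1 : 1 < -T := by linarith
  -- continuous version of `1 − c/log(−τ)`, frozen above `T`
  set a : ℝ → ℝ := fun τ => 1 - c / Real.log (max (-τ) (-T)) with ha
  have hmax1 : ∀ τ : ℝ, 1 < max (-τ) (-T) := fun τ => lt_of_lt_of_le hT1 (le_max_right _ _)
  have hlogpos : ∀ τ : ℝ, 0 < Real.log (max (-τ) (-T)) := fun τ => Real.log_pos (hmax1 τ)
  have hac : Continuous a := by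
    refine continuous_const.sub (continuous_const.div ?_ fun τ => (hlogpos τ).ne')
    exact (continuous_neg.max continuous_const).log fun τ => (lt_trans zero_lt_one (hmax1 τ)).ne'
  have haeq : ∀ τ, τ ≤ T → a τ = 1 - c / Real.log (-τ) := fun τ hτ => by
    simp only [ha, max_eq_left (neg_le_neg hτ)]
  refine const_of_stretching_divergent_deficit hc hK hd hm hT0 hac (A := 1)
    (fun τ _ => by
      have : 0 ≤ c / Real.log (max (-τ) (-T)) := div_nonneg hc0.le (hlogpos τ).le
      simp only [ha]; linarith)
    (fun τ hτ x => by rw [haeq τ hτ.le]; exact hstr τ hτ x) ?_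
  -- the deficit integral in closed form, eventually, and its divergence
  have hclosed : ∀ s < T, ∫ τ in s..T, (1 - a τ) / (-τ) =
      c * (Real.log (Real.log (-s)) - Real.log (Real.log (-T))) := by
    intro s hs
    rw [← integral_div_neg_mul_log_eq hs hT]
    refine intervalIntegral.integral_congr fun τ hτ => ?_
    rw [uIcc_of_le hs.le] at hτ
    rw [haeq τ hτ.2, sub_sub_cancel, div_div, mul_comm]
  have hlim : Tendsto (fun s : ℝ => c * (Real.log (Real.log (-s)) - Real.log (Real.log (-T)))) atBot atTop := by
    refine Tendsto.const_mul_atTop hc0 (tendsto_atTop_add_const_right _ _ ?_)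
    exact Real.tendsto_log_atTop.comp (Real.tendsto_log_atTop.comp tendsto_neg_atBot_atTop)
  refine hlim.congr' ?_
  filter_upwards [eventually_lt_atBot T] with s hs
  exact (hclosed s hs).symm

/-- **REFINED STRETCHING FLOOR OF A NON-CONSTANT BOUNDED ANCIENT FLOW.**  For a NON-CONSTANT class-P flow, every
`T < −1` and every `c > 0`: some `τ < T` and `x` carry stretching number `(−τ)·‖∇v(τ,x)‖ > 1 − c/log(−τ)`.  Sharpens
`exists_stretching_gt_of_nonconst` (`> a` for each constant `a < 1`): the unit threshold is approached at least
logarithmically fast along a sequence `τ → −∞`. [cite: MajdaBertozziCUP2002, eq. (3.80)] -/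
theorem exists_stretching_gt_one_sub_div_log_of_nonconst
    {v : ℝ → EuclideanSpace ℝ (Fin 3) → EuclideanSpace ℝ (Fin 3)}
    (hc : ContinuousOn (uncurry v) (Iio 0 ×ˢ univ))
    (hK : ∃ K : ℝ, ∀ t < 0, ∀ x, ‖v t x‖ ≤ K)
    (hd : ∀ t < 0, IsWeaklyDivFree (v t))
    (hm : ∀ s t : ℝ, s < t → t < 0 → ∀ x,
      v t x = heatExtension (v s) (t - s) x - oseenDuhamel 1 s v v t x)
    (hne : ¬ ∃ b : EuclideanSpace ℝ (Fin 3), ∀ t < 0, ∀ x, v t x = b)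
    {T c : ℝ} (hT : T < -1) (hc0 : 0 < c) :
    ∃ τ : ℝ, τ < T ∧ ∃ x : EuclideanSpace ℝ (Fin 3),
      1 - c / Real.log (-τ) < (-τ) * ‖fderiv ℝ (v τ) x‖ := by
  by_contra hcon
  push Not at hcon
  exact hne (const_of_stretching_le_one_sub_div_log hc hK hd hm hT hc0 fun τ hτ x => hcon τ hτ x)

end Summit.NavierStokesRegularity.NavierStokesRegularity.Theorems.TypeILiouvilleStrainLedger

end
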